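import Literature.MathematicalPhysics.QuantumFieldTheory.Balaban1983to89.Beta.MomentFactorisation
import Literature.MathematicalPhysics.QuantumFieldTheory.Balaban1983to89.Beta.MarginalTelescoping

/-!
# Beta/StrangFixMoment — the decimated second moment of a dressed kernel under Strang–Fix conditions of order 1

HONEST FRAMING (cell `pub-balaban`; B12 paper sub-cell, row b2b-balaban-b12-g9, journal claim B12-XREAD-V22, record
`HOME/b2b-balaban-b12-g9/B12-XREAD-V22.md` §3).  The β sub-cell tries to discharge the one-loop input of
[Balaban1987RG1] Theorem 2; that would make Bałaban's ultraviolet STABILITY theorem unconditional — NOT the continuum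
limit, NOT the Clay problem — and this file is far less: an elementary identity for finitely supported lattice
functions (Poisson summation / Strang–Fix conditions, done in position space).  Value = kernel certificate of a
structural step, NOT summit progress.  (Gloss 1, BETA-SPEC v1.8d/v1.9b l. 17–18, GAPS G-ref2-14 (a) / G-ref2-20 (a) /
G-ref2-27 (b), verbatim: «UNCONDITIONAL» in [Balaban1989LargeFieldII] (B16) p. 355's interval-hypothesis sense ONLY —
relative to the hypothesis `g_k ∈ ]0, γ]` along the run, which `FlowStepRuns.p355Unconditional_of_partialSums` keeps as
`hnodes`; the located leaves G-adv3-2 (left inequality of (0.1)/(2.50), d = 4), G-adv3-1 (U2 transfer of B14 Cor. 3's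
lower bound) and `SecondExpLeaf` REMAIN.  Gloss 2, BETA-SPEC v1.9e, beta-ref C-beta-78, BINDING: «unconditional» =
`Beta.Assembly.EventualForm`-unconditional END statement — the interval hypothesis removed, (0.31) in DEFECTED form on
all lattices (`PrefixAbsorption.thm2Defected_of_eventualForm`), admissible couplings shrunk — NOT «[Balaban1987RG1]
Theorem 2 as printed» (`PrefixAbsorption.eventualForm_not_thm2Printed`, RULING (R6)); never the continuum limit / mass
gap / Clay.  A Gloss 3′ for the composed road is PROPOSED in BETA-SPEC v1.9p §7.18 and not binding.)  THIS MODULE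
DISCHARGES NOTHING of the series.

WHAT IS IN PRINT (context only; the manuscripts are the object of the audit and are not used as facts).
[Balaban1987RG1] p. 264 (1.20)–(1.22): the β-function coefficient is the second moment `Σ_x Π(x) x_μ x_ν` of the
Hessian at zero of an effective-action term COMPOSED WITH THE BACKGROUND-FIELD MAP `B ↦ U_{j+1}(exp iB)` from
unit-lattice fields to fine-lattice configurations; p. 260 (1.3): the order-zero terms `log Z^{(j)}(U_k) − log Z^{(j)}(1)`
are fixed functionals re-evaluated at the current background, step after step.  Pulling a fine translation-invariant
kernel `T` back along a translation-COVARIANT coarse→fine linear map with response pattern `r` (the image of the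
coarse field `B` is `ξ ↦ Σ_w r(ξ − L•w) B(w)`) gives the coarse kernel `w ↦ (r ⋆ T ⋆ ř)(L•w)` (`ř(a) = r(−a)`): the
DECIMATION to the sublattice `L•ℤ^d` of the dressed kernel of `Beta/MomentFactorisation`.  In Fourier language its
symbol is the alias sum `Σ_ℓ r̂(p+2πℓ/L)* T̂(p+2πℓ/L) r̂(p+2πℓ/L)`; if `r` reproduces AFFINE functions — the
Strang–Fix conditions of order 1, [Buhmann2003] §4.2 (4.16)–(4.18) (PDF pp. 71–72: «These conditions (4.16)–(4.18)
are also known as the Strang and Fix conditions»): `r̂` vanishes to second order at every alias point — and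
`T̂(0) = 0` (a zero-momentum Ward identity), then the alias (umklapp) sector is `O(p⁴)` and the `p²`-jet of the
pulled-back symbol is that of `T̂`: the second moment is unchanged by dressing-and-decimation.  With reproduction of
CONSTANTS only it is not (the order-`p` alias responses contribute at order `p²`; exact rational examples in the
record).

WHAT THIS FILE PROVES (all [folklore]; COMMUTATIVE ring `R` — scalar response patterns; lattice `Fin d → ℤ`; sums
finite over arbitrary finsets `Sr ∋ x, y`, `ST ∋ t`; `chiZ L u = 1` if `u ∈ L•ℤ^d` else `0`, `chi L a b = chiZ L (a − b)`,
`G L Sr ST r T f = Σ_{x∈Sr} Σ_{t∈ST} Σ_{y∈Sr} chi L (x+t) y · f x t y · (r x · T t · r y)`):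
* `first_moment_of_strangFix`: (SF0) `∀ x', Σ_{y∈Sr} chi L x' y · r y = 1` (every comb sum of `r` is `1`: constants are
  reproduced) and (SF1) `∀ x' ν, Σ_{y∈Sr} chi L x' y · y_ν · r y = s_ν` (the first comb moments do not depend on the
  coset) imply `Σ_x x_μ r x = s_μ · Σ_x r x`;
* `affine_iff_firstCombMoment`: given (SF0), (SF1) ⟺ `∀ x' ν, Σ_y chi L x' y · (x'_ν − y_ν) · r y = x'_ν − s_ν`
  (the coordinate functions are reproduced up to the shift `s`: (SF0)+(SF1) = reproduction of affine functions);
* `strangFix_second_moment` (the theorem): (SF0), (SF1) and (W0) `Σ_{t∈ST} T t = 0` imply, for all `μ ν`,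
  `G L Sr ST r T ((x+t−y)_μ (x+t−y)_ν) = (Σ_{x∈Sr} r x) · Σ_{t∈ST} t_μ t_ν T t`;
* `decimatedM2_dressed` (the same in the vocabulary of `Beta/MomentFactorisation`): for `r T : LatFun d R` with
  (SF0), (SF1) over `r.support` and `M0 T = 0`,
  `decimatedM2 L μ ν (conv (conv r T) (reflect r)) = M0 r * M2 μ ν T`, where
  `decimatedM2 L μ ν f = moment (χ_{L•ℤ^d} · u_μ u_ν) f = Σ_{u ∈ L•ℤ^d} u_μ u_ν f(u)` — the decimated second moment of
  the dressed kernel is the UNDRESSED second moment of `T` times the mass of `r` (`= L^d`, the number of cosets, under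
  (SF0)).  No evenness and no vanishing first moment of `T` is needed; (SF1) cannot be dropped (record §3.3: the
  block-constant pattern, d = 1, L = 2, exact rationals; kernel witness in the two-sided vocabulary:
  `DecimatedMoment.witness_L1_needed`, `8 ≠ 4`).
* `identityForm_of_stepInvariant` / `composedCoeff_eq_flowSum_of_stepInvariant` (v1.1, the bearing on
  `Beta/MarginalTelescoping`): if the old-term contributions do not change from one step to the next,
  `∀ j < k, μ j (k+1) = μ j k`, then `IdentityForm μ (fun j => μ j (j+1))` and `composedCoeff μ k = flowSum (μ · (·+1)) k`
  (defect zero) — elementary induction; the content is in establishing step-invariance, for which the theorem above is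
  the mechanism.
The proof is the nine-term expansion of `(x+t−y)_μ (x+t−y)_ν`, each term evaluated by summing first over the variable
that (SF0)/(SF1) control (comb sums over `y ≡ x+t`, or over `x ≡ y−t` by `chi_shift`), then (W0) and
`first_moment_of_strangFix`; `decimatedM2_dressed_eq_G` unfolds `conv ∘ conv ∘ reflect` into `G` as in
`MomentFactorisation.moment_conv`.

HOW IT IS MEANT TO BE USED (record B12-XREAD-V22 §2–§4; nothing of it is asserted here).  With `r` = the response
pattern of the linearised one-step background map (affine-reproducing modulo linearised gauge transformations: the
cell's (AFF-lin), HOME/BETA/AN2.md §8.10(c)) and `T` = the Hessian at the trivial configuration of a carried order-zero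
term (zero-momentum Ward identity = the cell's Lemma W, `Beta/WardIdentity`; criticality and exact transversality of
the quadratic form = [Balaban1987RG1] (4.14), (4.15), p. 284), the identity says that the (1.22)-moment of a carried
term does not change from one scale to the next — `Beta/MarginalTelescoping.IdentityForm` with zero defect — so the
flow sum of the β⁰'s is the composed one-loop coefficient; and, one level down, that the seven terms of
`MomentFactorisation.M2_dressed_ward` total to the intrinsic fine second moment.  WHAT THIS DOES NOT COVER: the
one-form / «modulo gauge» bookkeeping — there the left and right patterns differ (`u ↦ w(u)ᵀ` vs `w`), `r`, `T` are
matrix-valued (direction ⊗ colour) and the coset first-moment constants are generically NON-CENTRAL matrices, so the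
two `M1 T`-cross terms of the nine-term expansion do not cancel as they do here and the additional input `M1_μ T = 0`
(reflection parity of the Hessian kernel) is what removes them; moreover the raw one-step response satisfies
(SF0)/(SF1) only modulo exact patterns and is first reduced by subtracting a pure-gradient part, which `T` kills on
both sides — this two-sided, any-ring, any-window version is the an2 row's `Beta/DecimatedMoment` (cell node
BETA-an2-DECIMATED-MOMENT), of which the present module is the commutative special case; kernels of infinite support
(Bałaban's kernels decay exponentially; extension by dominated convergence not done); any identification of `r`, `T`
with Bałaban's operators; the second chain-rule term of (1.20).
An exact rational toy check (d = 1, `L = 2, 3, 4`: the piecewise-linear pattern satisfies (SF0)+(SF1) and gives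
equality, the block-constant pattern satisfies (SF0) only and does not; the block-mean-constrained harmonic minimiser
converges to equality with the window) accompanies the record.  NOT summit progress; NOT continuum, NOT Clay.

References: T. Bałaban, Commun. Math. Phys. 109 (1987) 249–301 [Balaban1987RG1] ((1.3) p. 260; (1.20)–(1.22) p. 264;
(4.14)–(4.15) p. 284); M. D. Buhmann, Radial Basis Functions, CUP 2003 [Buhmann2003] (§4.2 (4.16)–(4.18), the Strang
and Fix conditions).  Unit `b2b-balaban-b12-g9` (B12 paper sub-cell, gen 9), journal claim B12-XREAD-V22; v1.0 = p181496;
v1.1 = v1.0 + the section «Bearing on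
`Beta/MarginalTelescoping`» (`identityForm_of_stepInvariant`, `composedCoeff_eq_flowSum_of_stepInvariant`; one more import,
`Beta.MarginalTelescoping`; v1.0's declarations unchanged) = p181521; v1.2 = DOCFIX of this paragraph only (the one-form
clause rewritten after the an2 row's cross-seat note: non-central coset constants, `M1 T = 0` as the extra input,
reduction modulo exact patterns; declarations byte-identical to v1.1) = p181540; v1.3 (unit `b2b-balaban-b12-g10`,
gen 10, journal claim DOCFIX-G-ref2-27b) = DOCFIX of this module docstring only (Gloss 1 + Gloss 2 added to the
HONEST FRAMING paragraph per GAPS G-ref2-27 (b); the cross-read advisories REFEREE6 E77 A1 (pointer next to «(SF1)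
cannot be dropped») and A2 (one overlong line folded) taken up; code byte-identical to v1.2);
[Balaban1989LargeFieldII] = T. Bałaban, Commun. Math. Phys. 122
(1989) 355–392 (p. 355, context of Gloss 1 only); staged byte-identically under `HOME/lean/BalabanYm4/Literature/…/Beta/`.
NOT summit progress.
-/

namespace Literature.MathematicalPhysics.QuantumFieldTheory.Balaban1983to89.Beta.StrangFixMoment

open Finset

variable {d : ℕ} {R : Type*} [CommRing R]

/-- Integer indicator of the sublattice `L•ℤ^d`: `chiZ L u = 1` if `L ∣ u_i` for all `i`, else `0`. [folklore] -/
noncomputable def chiZ (L : ℕ) (u : Fin d → ℤ) : ℤ :=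
  by classical exact if (∀ i, (L : ℤ) ∣ u i) then 1 else 0

/-- Coset indicator with values in `R`: `chi L a b = 1` if `a ≡ b (mod L)` componentwise, else `0`. [folklore] -/
noncomputable def chi (L : ℕ) (a b : Fin d → ℤ) : R := ((chiZ L (a - b) : ℤ) : R)

/-- The indicator is symmetric. [folklore] -/
theorem chi_symm (L : ℕ) (a b : Fin d → ℤ) : (chi L a b : R) = chi L b a := by
  have h : (∀ i, (L : ℤ) ∣ (a - b) i) ↔ (∀ i, (L : ℤ) ∣ (b - a) i) :=
    forall_congr' fun i => by simp only [Pi.sub_apply]; exact dvd_sub_comm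
  unfold chi chiZ
  simp only [h]

/-- Shifting the first argument by `t` is shifting the second by `−t`. [folklore] -/
theorem chi_shift (L : ℕ) (x t y : Fin d → ℤ) : (chi L (x + t) y : R) = chi L (y - t) x := by
  have h : (∀ i, (L : ℤ) ∣ (x + t - y) i) ↔ (∀ i, (L : ℤ) ∣ (y - t - x) i) := by
    refine forall_congr' fun i => ?_
    rw [show (y - t - x) i = -((x + t - y) i) by simp only [Pi.add_apply, Pi.sub_apply]; ring, dvd_neg]
  unfold chi chiZ
  simp only [h]

/-- With the second argument `0` the two-point indicator is the sublattice indicator. [folklore] -/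
theorem chi_zero_right (L : ℕ) (u : Fin d → ℤ) : (chi L u 0 : R) = ((chiZ L u : ℤ) : R) := by
  unfold chi
  rw [sub_zero]

/-- The dressed-and-decimated triple sum with a general weight `f x t y`. [folklore] -/
noncomputable def G (L : ℕ) (Sr ST : Finset (Fin d → ℤ)) (r T : (Fin d → ℤ) → R)
    (f : (Fin d → ℤ) → (Fin d → ℤ) → (Fin d → ℤ) → R) : R :=
  ∑ x ∈ Sr, ∑ t ∈ ST, ∑ y ∈ Sr, chi L (x + t) y * f x t y * (r x * T t * r y)

/-- `G` is additive in the weight. [folklore] -/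
theorem G_add (L : ℕ) (Sr ST : Finset (Fin d → ℤ)) (r T : (Fin d → ℤ) → R)
    (f g : (Fin d → ℤ) → (Fin d → ℤ) → (Fin d → ℤ) → R) :
    G L Sr ST r T (f + g) = G L Sr ST r T f + G L Sr ST r T g := by
  unfold G
  simp only [Pi.add_apply, mul_add, add_mul, Finset.sum_add_distrib]

/-- `G` respects differences of weights. [folklore] -/
theorem G_sub (L : ℕ) (Sr ST : Finset (Fin d → ℤ)) (r T : (Fin d → ℤ) → R)
    (f g : (Fin d → ℤ) → (Fin d → ℤ) → (Fin d → ℤ) → R) :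
    G L Sr ST r T (f - g) = G L Sr ST r T f - G L Sr ST r T g := by
  unfold G
  simp only [Pi.sub_apply, mul_sub, sub_mul, Finset.sum_sub_distrib]

section Evaluations

variable (L : ℕ) (Sr ST : Finset (Fin d → ℤ)) (r T : (Fin d → ℤ) → R) (s : Fin d → R)

/-- Inner `y`-sum controlled by (SF0): weights depending on `x, t` only. [folklore] -/
theorem G_of_xt (hSF0 : ∀ x' : Fin d → ℤ, ∑ y ∈ Sr, chi L x' y * r y = 1)
    (g : (Fin d → ℤ) → (Fin d → ℤ) → R) :
    G L Sr ST r T (fun x t _ => g x t) = ∑ x ∈ Sr, ∑ t ∈ ST, g x t * (r x * T t) := by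
  unfold G
  refine Finset.sum_congr rfl fun x _ => Finset.sum_congr rfl fun t _ => ?_
  have h1 : ∑ y ∈ Sr, chi L (x + t) y * g x t * (r x * T t * r y)
      = g x t * (r x * T t) * ∑ y ∈ Sr, chi L (x + t) y * r y := by
    rw [Finset.mul_sum]
    exact Finset.sum_congr rfl fun y _ => by ring
  rw [h1, hSF0 (x + t), mul_one]

/-- Inner `y`-sum controlled by (SF1): weights `g x t · y_ν`. [folklore] -/
theorem G_of_xt_y (hSF1 : ∀ (x' : Fin d → ℤ) (ν : Fin d), ∑ y ∈ Sr, chi L x' y * (y ν : R) * r y = s ν)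
    (g : (Fin d → ℤ) → (Fin d → ℤ) → R) (ν : Fin d) :
    G L Sr ST r T (fun x t y => g x t * (y ν : R)) = ∑ x ∈ Sr, ∑ t ∈ ST, g x t * s ν * (r x * T t) := by
  unfold G
  refine Finset.sum_congr rfl fun x _ => Finset.sum_congr rfl fun t _ => ?_
  have h1 : ∑ y ∈ Sr, chi L (x + t) y * (g x t * (y ν : R)) * (r x * T t * r y)
      = g x t * (r x * T t) * ∑ y ∈ Sr, chi L (x + t) y * (y ν : R) * r y := by
    rw [Finset.mul_sum]
    exact Finset.sum_congr rfl fun y _ => by ring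
  rw [h1, hSF1 (x + t) ν]
  ring

/-- Inner `x`-sum controlled by (SF0) at the shifted point `y − t`: weights depending on `t, y` only. [folklore] -/
theorem G_of_ty (hSF0 : ∀ x' : Fin d → ℤ, ∑ y ∈ Sr, chi L x' y * r y = 1)
    (g : (Fin d → ℤ) → (Fin d → ℤ) → R) :
    G L Sr ST r T (fun _ t y => g t y) = ∑ t ∈ ST, ∑ y ∈ Sr, g t y * (T t * r y) := by
  unfold G
  rw [Finset.sum_comm]
  refine Finset.sum_congr rfl fun t _ => ?_
  rw [Finset.sum_comm]
  refine Finset.sum_congr rfl fun y _ => ?_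
  have h1 : ∑ x ∈ Sr, chi L (x + t) y * g t y * (r x * T t * r y)
      = g t y * (T t * r y) * ∑ x ∈ Sr, chi L (y - t) x * r x := by
    rw [Finset.mul_sum]
    exact Finset.sum_congr rfl fun x _ => by rw [chi_shift]; ring
  rw [h1, hSF0 (y - t), mul_one]

/-- **First moments under Strang–Fix order 1**: `Σ_x x_μ r x = s_μ · Σ_x r x`. [folklore] -/
theorem first_moment_of_strangFix (hSF0 : ∀ x' : Fin d → ℤ, ∑ y ∈ Sr, chi L x' y * r y = 1)
    (hSF1 : ∀ (x' : Fin d → ℤ) (ν : Fin d), ∑ y ∈ Sr, chi L x' y * (y ν : R) * r y = s ν) (μ : Fin d) :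
    ∑ x ∈ Sr, (x μ : R) * r x = s μ * ∑ x ∈ Sr, r x := by
  -- Ξ := Σ_x Σ_y χ(x,y) y_μ r y r x, summed in the two orders
  have hy : ∑ x ∈ Sr, ∑ y ∈ Sr, chi L x y * (y μ : R) * r y * r x = s μ * ∑ x ∈ Sr, r x := by
    rw [Finset.mul_sum]
    refine Finset.sum_congr rfl fun x _ => ?_
    rw [← Finset.sum_mul, hSF1 x μ]
  have hx : ∑ x ∈ Sr, ∑ y ∈ Sr, chi L x y * (y μ : R) * r y * r x = ∑ y ∈ Sr, (y μ : R) * r y := by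
    rw [Finset.sum_comm]
    refine Finset.sum_congr rfl fun y _ => ?_
    have h1 : ∑ x ∈ Sr, chi L x y * (y μ : R) * r y * r x = (y μ : R) * r y * ∑ x ∈ Sr, chi L y x * r x := by
      rw [Finset.mul_sum]
      exact Finset.sum_congr rfl fun x _ => by rw [chi_symm]; ring
    rw [h1, hSF0 y, mul_one]
  rw [← hx, hy]

/-- (SF1) in the two equivalent forms, given (SF0): reproduction of the coordinate functions up to a shift,
`Σ_y χ_L(x',y) (x' − y)_ν r y = x'_ν − s_ν`, versus coset-independence of the first comb moments,
`Σ_y χ_L(x',y) y_ν r y = s_ν`. [folklore] -/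
theorem affine_iff_firstCombMoment (hSF0 : ∀ x' : Fin d → ℤ, ∑ y ∈ Sr, chi L x' y * r y = 1) :
    (∀ (x' : Fin d → ℤ) (ν : Fin d), ∑ y ∈ Sr, chi L x' y * ((x' ν : R) - (y ν : R)) * r y = (x' ν : R) - s ν)
      ↔ (∀ (x' : Fin d → ℤ) (ν : Fin d), ∑ y ∈ Sr, chi L x' y * (y ν : R) * r y = s ν) := by
  have key : ∀ (x' : Fin d → ℤ) (ν : Fin d),
      ∑ y ∈ Sr, chi L x' y * ((x' ν : R) - (y ν : R)) * r y
        = (x' ν : R) - ∑ y ∈ Sr, chi L x' y * (y ν : R) * r y := by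
    intro x' ν
    have h1 : ∑ y ∈ Sr, chi L x' y * ((x' ν : R) - (y ν : R)) * r y
        = (x' ν : R) * ∑ y ∈ Sr, chi L x' y * r y - ∑ y ∈ Sr, chi L x' y * (y ν : R) * r y := by
      rw [Finset.mul_sum, ← Finset.sum_sub_distrib]
      exact Finset.sum_congr rfl fun y _ => by ring
    rw [h1, hSF0 x', mul_one]
  constructor
  · intro h x' ν
    have := h x' ν
    rw [key] at this
    linear_combination -this
  · intro h x' ν
    rw [key, h x' ν]

/-- **The decimated second moment of a dressed kernel under Strang–Fix conditions of order 1.**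
`Σ_{x,t,y} χ_L(x+t,y) (x+t−y)_μ (x+t−y)_ν r x T t r y = (Σ_x r x) · Σ_t t_μ t_ν T t`, i.e.
`Σ_{u ∈ L•ℤ^d} u_μ u_ν (r ⋆ T ⋆ ř)(u) = M0 r · M2_{μν} T`. [folklore] -/
theorem strangFix_second_moment (hSF0 : ∀ x' : Fin d → ℤ, ∑ y ∈ Sr, chi L x' y * r y = 1)
    (hSF1 : ∀ (x' : Fin d → ℤ) (ν : Fin d), ∑ y ∈ Sr, chi L x' y * (y ν : R) * r y = s ν)
    (hW0 : ∑ t ∈ ST, T t = 0) (μ ν : Fin d) :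
    G L Sr ST r T (fun x t y => (((x + t - y) μ * (x + t - y) ν : ℤ) : R))
      = (∑ x ∈ Sr, r x) * ∑ t ∈ ST, ((t μ * t ν : ℤ) : R) * T t := by
  -- the nine monomials
  set f1 : (Fin d → ℤ) → (Fin d → ℤ) → (Fin d → ℤ) → R := fun x t _ => (x μ : R) * (x ν : R) with hf1
  set f2 : (Fin d → ℤ) → (Fin d → ℤ) → (Fin d → ℤ) → R := fun x t _ => (x μ : R) * (t ν : R) with hf2
  set f3 : (Fin d → ℤ) → (Fin d → ℤ) → (Fin d → ℤ) → R := fun x t y => (x μ : R) * (y ν : R) with hf3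
  set f4 : (Fin d → ℤ) → (Fin d → ℤ) → (Fin d → ℤ) → R := fun x t _ => (t μ : R) * (x ν : R) with hf4
  set f5 : (Fin d → ℤ) → (Fin d → ℤ) → (Fin d → ℤ) → R := fun x t _ => (t μ : R) * (t ν : R) with hf5
  set f6 : (Fin d → ℤ) → (Fin d → ℤ) → (Fin d → ℤ) → R := fun x t y => (t μ : R) * (y ν : R) with hf6
  set f7 : (Fin d → ℤ) → (Fin d → ℤ) → (Fin d → ℤ) → R := fun x t y => (x ν : R) * (y μ : R) with hf7
  set f8 : (Fin d → ℤ) → (Fin d → ℤ) → (Fin d → ℤ) → R := fun x t y => (t ν : R) * (y μ : R) with hf8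
  set f9 : (Fin d → ℤ) → (Fin d → ℤ) → (Fin d → ℤ) → R := fun _ t y => (y μ : R) * (y ν : R) with hf9
  have hw : (fun x t y => (((x + t - y) μ * (x + t - y) ν : ℤ) : R))
      = f1 + f2 - f3 + f4 + f5 - f6 - f7 - f8 + f9 := by
    funext x t y
    simp only [hf1, hf2, hf3, hf4, hf5, hf6, hf7, hf8, hf9, Pi.add_apply, Pi.sub_apply]
    push_cast
    ring
  rw [hw]
  simp only [G_add, G_sub]
  -- evaluate each monomial
  have h1 : G L Sr ST r T f1 = (∑ x ∈ Sr, (x μ : R) * (x ν : R) * r x) * ∑ t ∈ ST, T t := by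
    rw [hf1, G_of_xt L Sr ST r T hSF0 (fun x _ => (x μ : R) * (x ν : R))]
    rw [Finset.sum_mul_sum]
    exact Finset.sum_congr rfl fun x _ => Finset.sum_congr rfl fun t _ => by ring
  have h2 : G L Sr ST r T f2 = (∑ x ∈ Sr, (x μ : R) * r x) * ∑ t ∈ ST, (t ν : R) * T t := by
    rw [hf2, G_of_xt L Sr ST r T hSF0 (fun x t => (x μ : R) * (t ν : R))]
    rw [Finset.sum_mul_sum]
    exact Finset.sum_congr rfl fun x _ => Finset.sum_congr rfl fun t _ => by ring
  have h3 : G L Sr ST r T f3 = (∑ x ∈ Sr, (x μ : R) * r x) * (∑ t ∈ ST, T t) * s ν := by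
    rw [hf3, G_of_xt_y L Sr ST r T s hSF1 (fun x _ => (x μ : R)) ν]
    rw [Finset.sum_mul_sum, Finset.sum_mul]
    refine Finset.sum_congr rfl fun x _ => ?_
    rw [Finset.sum_mul]
    exact Finset.sum_congr rfl fun t _ => by ring
  have h4 : G L Sr ST r T f4 = (∑ x ∈ Sr, (x ν : R) * r x) * ∑ t ∈ ST, (t μ : R) * T t := by
    rw [hf4, G_of_xt L Sr ST r T hSF0 (fun x t => (t μ : R) * (x ν : R))]
    rw [Finset.sum_mul_sum]
    exact Finset.sum_congr rfl fun x _ => Finset.sum_congr rfl fun t _ => by ring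
  have h5 : G L Sr ST r T f5 = (∑ x ∈ Sr, r x) * ∑ t ∈ ST, (t μ : R) * (t ν : R) * T t := by
    rw [hf5, G_of_xt L Sr ST r T hSF0 (fun _ t => (t μ : R) * (t ν : R))]
    rw [Finset.sum_mul_sum]
    exact Finset.sum_congr rfl fun x _ => Finset.sum_congr rfl fun t _ => by ring
  have h6 : G L Sr ST r T f6 = (∑ x ∈ Sr, r x) * (∑ t ∈ ST, (t μ : R) * T t) * s ν := by
    rw [hf6, G_of_xt_y L Sr ST r T s hSF1 (fun _ t => (t μ : R)) ν]
    rw [Finset.sum_mul_sum, Finset.sum_mul]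
    refine Finset.sum_congr rfl fun x _ => ?_
    rw [Finset.sum_mul]
    exact Finset.sum_congr rfl fun t _ => by ring
  have h7 : G L Sr ST r T f7 = (∑ x ∈ Sr, (x ν : R) * r x) * (∑ t ∈ ST, T t) * s μ := by
    rw [hf7, G_of_xt_y L Sr ST r T s hSF1 (fun x _ => (x ν : R)) μ]
    rw [Finset.sum_mul_sum, Finset.sum_mul]
    refine Finset.sum_congr rfl fun x _ => ?_
    rw [Finset.sum_mul]
    exact Finset.sum_congr rfl fun t _ => by ring
  have h8 : G L Sr ST r T f8 = (∑ x ∈ Sr, r x) * (∑ t ∈ ST, (t ν : R) * T t) * s μ := by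
    rw [hf8, G_of_xt_y L Sr ST r T s hSF1 (fun _ t => (t ν : R)) μ]
    rw [Finset.sum_mul_sum, Finset.sum_mul]
    refine Finset.sum_congr rfl fun x _ => ?_
    rw [Finset.sum_mul]
    exact Finset.sum_congr rfl fun t _ => by ring
  have h9 : G L Sr ST r T f9 = (∑ t ∈ ST, T t) * ∑ y ∈ Sr, (y μ : R) * (y ν : R) * r y := by
    rw [hf9, G_of_ty L Sr ST r T hSF0 (fun _ y => (y μ : R) * (y ν : R))]
    rw [Finset.sum_mul_sum]
    exact Finset.sum_congr rfl fun t _ => Finset.sum_congr rfl fun y _ => by ring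
  have hM1μ := first_moment_of_strangFix L Sr r s hSF0 hSF1 μ
  have hM1ν := first_moment_of_strangFix L Sr r s hSF0 hSF1 ν
  have hM2 : ∑ t ∈ ST, ((t μ * t ν : ℤ) : R) * T t = ∑ t ∈ ST, (t μ : R) * (t ν : R) * T t :=
    Finset.sum_congr rfl fun t _ => by push_cast; ring
  rw [h1, h2, h3, h4, h5, h6, h7, h8, h9, hW0, hM2, hM1μ, hM1ν]
  ring

end Evaluations

/-! ## The same identity in the vocabulary of `Beta/MomentFactorisation` (`conv`, `reflect`, `moment`, `M0`, `M2`)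

For finitely supported `r T : LatFun d R` the weight-`χ_{L•ℤ^d}(u) u_μ u_ν` moment of the dressed kernel
`conv (conv r T) (reflect r) = r ⋆ T ⋆ ř` is the triple sum `G` over the supports, so `strangFix_second_moment` reads
`moment (χ_{L•ℤ^d} · u_μ u_ν) (r ⋆ T ⋆ ř) = M0 r · M2_{μν} T`. -/

section Dressed

open Literature.MathematicalPhysics.QuantumFieldTheory.Balaban1983to89.Beta.MomentFactorisation

variable (L : ℕ)

/-- The DECIMATED second moment `Σ_{u ∈ L•ℤ^d} u_μ u_ν f(u)` of a finitely supported lattice function: the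
`moment` with integer weight `χ_{L•ℤ^d}(u) · u_μ u_ν`.  For `L = 1` it is `M2 μ ν f`. [folklore] -/
noncomputable def decimatedM2 (μ ν : Fin d) (f : LatFun d R) : R :=
  moment (fun u => chiZ L u * (u μ * u ν)) f

/-- `M0` as a sum over the support. [folklore] -/
theorem M0_eq_finsetSum (f : LatFun d R) : M0 f = ∑ x ∈ f.support, f x := by
  simp only [M0, moment, one_smul]
  rfl

/-- `M2` as a sum over the support. [folklore] -/
theorem M2_eq_finsetSum (μ ν : Fin d) (f : LatFun d R) :
    M2 μ ν f = ∑ x ∈ f.support, ((x μ * x ν : ℤ) : R) * f x := by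
  simp only [M2, moment, zsmul_eq_mul]
  rfl

/-- The decimated second moment of `r ⋆ T ⋆ ř` as the triple sum `G` over the supports. [folklore] -/
theorem decimatedM2_dressed_eq_G (μ ν : Fin d) (r T : LatFun d R) :
    decimatedM2 L μ ν (conv (conv r T) (reflect r))
      = G L r.support T.support (fun x => r x) (fun t => T t)
          (fun x t y => (((x + t - y) μ * (x + t - y) ν : ℤ) : R)) := by
  -- Step 1: the outer convolution, by `moment_conv`, and the reflection, by `sum_mapDomain_index`.
  set ψ : (Fin d → ℤ) → ℤ := fun u => chiZ L u * (u μ * u ν) with hψ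
  have e1 : decimatedM2 L μ ν (conv (conv r T) (reflect r))
      = (conv r T).sum fun z c => (reflect r).sum fun y b => ψ (z + y) • (c * b) := by
    unfold decimatedM2
    exact moment_conv ψ _ _
  set H : (Fin d → ℤ) → R → R := fun z c => r.sum fun y b => ψ (z + -y) • (c * b) with hH
  have e2 : ∀ (z : Fin d → ℤ) (c : R),
      ((reflect r).sum fun y b => ψ (z + y) • (c * b)) = H z c := by
    intro z c
    rw [hH]
    unfold reflect
    exact Finsupp.sum_mapDomain_index (fun _ => by simp only [mul_zero, smul_zero])
      (fun _ _ _ => by simp only [mul_add, smul_add])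
  have hz : ∀ z : Fin d → ℤ, H z 0 = 0 := by
    intro z
    simp only [hH, zero_mul, smul_zero, Finsupp.sum, Finset.sum_const_zero]
  have ha : ∀ (z : Fin d → ℤ) (c₁ c₂ : R), H z (c₁ + c₂) = H z c₁ + H z c₂ := by
    intro z c₁ c₂
    simp only [hH, add_mul, smul_add, Finsupp.sum_add]
  -- Step 2: the inner convolution, as in `moment_conv`.
  have e3 : ((conv r T).sum fun z c => H z c) = r.sum fun x a => T.sum fun t c => H (x + t) (a * c) := by
    unfold conv
    rw [Finsupp.sum_sum_index hz ha]
    apply Finsupp.sum_congr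
    intro x _
    rw [Finsupp.sum_sum_index hz ha]
    apply Finsupp.sum_congr
    intro t _
    exact Finsupp.sum_single_index (hz _)
  rw [e1]
  rw [show ((conv r T).sum fun z c => (reflect r).sum fun y b => ψ (z + y) • (c * b))
      = (conv r T).sum fun z c => H z c from Finsupp.sum_congr fun z _ => e2 z _]
  rw [e3]
  -- Step 3: unfold to finset sums and compare summands.
  unfold G
  simp only [Finsupp.sum, hH]
  refine Finset.sum_congr rfl fun x _ => Finset.sum_congr rfl fun t _ => Finset.sum_congr rfl fun y _ => ?_
  rw [hψ, chi, zsmul_eq_mul, ← sub_eq_add_neg]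
  push_cast
  ring

/-- **Corollary (vocabulary of `Beta/MomentFactorisation`).**  Under (SF0), (SF1) for `r` (comb sums over its support)
and `M0 T = 0`: `Σ_{u ∈ L•ℤ^d} u_μ u_ν (r ⋆ T ⋆ ř)(u) = M0 r · M2_{μν} T`. [folklore] -/
theorem decimatedM2_dressed (r T : LatFun d R) (s : Fin d → R)
    (hSF0 : ∀ x' : Fin d → ℤ, ∑ y ∈ r.support, chi L x' y * r y = 1)
    (hSF1 : ∀ (x' : Fin d → ℤ) (ν : Fin d), ∑ y ∈ r.support, chi L x' y * (y ν : R) * r y = s ν)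
    (hW0 : M0 T = 0) (μ ν : Fin d) :
    decimatedM2 L μ ν (conv (conv r T) (reflect r)) = M0 r * M2 μ ν T := by
  have hW0' : ∑ t ∈ T.support, T t = 0 := by rw [← M0_eq_finsetSum]; exact hW0
  rw [decimatedM2_dressed_eq_G, M0_eq_finsetSum, M2_eq_finsetSum]
  exact strangFix_second_moment L r.support T.support (fun x => r x) (fun t => T t) s hSF0 hSF1 hW0' μ ν

end Dressed

/-! ## Bearing on `Beta/MarginalTelescoping`: step-invariance of the carried moments is the identity shape (I)

If the contribution `μ j k` of the old term `j` does not change from step `k` to step `k+1` (for `k > j`; this is what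
`strangFix_second_moment` delivers for the (1.22)-moment of a carried order-zero term once its hypotheses are
established for the one-step background map and the term's Hessian), then `μ j k = μ j (j+1)` for all `k > j`, i.e.
`MarginalTelescoping.IdentityForm μ (fun j => μ j (j+1))`, and the composed coefficient IS the flow sum
(`MarginalTelescoping.composedCoeff_eq_flowSum_of_identity`): defect zero. -/

section Bearing

open Literature.MathematicalPhysics.QuantumFieldTheory.Balaban1983to89.Beta.MarginalTelescoping

/-- Step-invariance of the old-term contributions, `μ j (k+1) = μ j k` for `j < k`, gives the identity shape (I) with
`β0 j := μ j (j+1)`. [folklore] -/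
theorem identityForm_of_stepInvariant (μ : ℕ → ℕ → ℝ) (h : ∀ j k : ℕ, j < k → μ j (k + 1) = μ j k) :
    IdentityForm μ (fun j => μ j (j + 1)) := by
  intro j k hjk
  -- induction on the gap `k − (j+1)`
  obtain ⟨n, rfl⟩ : ∃ n, k = j + 1 + n := ⟨k - (j + 1), by omega⟩
  induction n with
  | zero => simp
  | succ n ih =>
    have hlt : j < j + 1 + n := by omega
    rw [show j + 1 + (n + 1) = (j + 1 + n) + 1 by ring, h (j) (j + 1 + n) hlt]
    exact ih hlt

/-- Hence, under step-invariance, the composed coefficient is the flow sum of the first contributions (defect zero).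
[folklore] -/
theorem composedCoeff_eq_flowSum_of_stepInvariant (μ : ℕ → ℕ → ℝ)
    (h : ∀ j k : ℕ, j < k → μ j (k + 1) = μ j k) (k : ℕ) :
    composedCoeff μ k = flowSum (fun j => μ j (j + 1)) k :=
  composedCoeff_eq_flowSum_of_identity (identityForm_of_stepInvariant μ h) k

end Bearing

end Literature.MathematicalPhysics.QuantumFieldTheory.Balaban1983to89.Beta.StrangFixMoment
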